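import Mathlib.Tactic
import HarnessLib

/-!
# Kozma–Nitzan's Question 8 — the R-free universal k = 2 merge step (RC-G⁰) (gen 34)

Support file (`--supports stmt-CriticalPhenomena-4575`, closed crux; independent mathematics on Kozma–Nitzan's Question 8,
arXiv:2401.12397 §5.5 p. 36), prover `prim-ineq-gen-6` (gen 34).  No definitions, no named facts, no sorries; standard axioms.
Memo `run/shared/lean/prim/prim-ineq-gen-6/FINDING-G34.md` §3(d).

The sub-root reduction of the nested uniform form (…KnQuestion8SubrootReduction.lean) needs the uniform form WITHOUT its R-kill,
`UNIF-G⁰`.  At a crossing `k = 2` this is the k = 2 merge step `(RC-G)` of FINDING-G31 §5c with the kill `R₁′ = ¾C(v/p)(1−A)/A`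
deleted: `N1 + N3 ≤ Ka + Kb + LL′ + HY`.  The only use of `R₁′` in the proved `(RC-G)` is the remainder `¾p₀` of CLAIM Z; the memo
shows that this remainder is paid by the slack of the `w = 0` chain instead: with `a = 1−A`, `c = 1−C`, `d = A−C > 0`,
`λ′ = λ − c(1+λ)`, the exact far-factor identity `A·p = p₀ + s·d·u − C·a·q` (`kG0_Ap`) turns the depth-0 excess into
`a[(1−λ²)A p B_p/p₀ − B_q] ≤ (a/A)(1−λ²)(s d u − C a q)⁺` (`kG0_xz_bound`), the `w = 0` kills leave the slack
`s·u·φ(x)`, `φ(x) = x − λ′ − λd + cλ²A/x` (`kG0_spare`, `x = v/m`, Chebyshev `T′m ≥ uv`), and the scalar lemma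
`A·Q(x) ≥ a(1−λ²)d·x` for `x ≥ λ′` (`kG0_scalar`, from the two polynomial facts `kG0_F1`, `kG0_G2`) closes the step.
Consequence (memo, exact-checked on 17 238 blocks): `UNIF-G⁰` holds at every crossing `k = 2` — the R-free universal `NX′₂`.
[cite: KozmaNitzan2024, Question 8 (§5.5 p. 36)]
-/

namespace Summit.CriticalPhenomena.PercolationContinuityZ3.Theorems

namespace PocketCert

/-- **F1** (the `t = 0` endpoint of the scalar lemma, multiplied by `A = 1−a`):  for `0 ≤ a ≤ c`, `c(1+λ) ≤ λ ≤ 1`: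
`(λ − c(1+λ))·(c−a)·[λ(1−a) + a(1−λ²)] ≤ c·λ²·(1−a)²`.  Proof: `c − a ≤ c(1−a)`, then `λa(1−λ²) ≤ c(1+λ)[λ(1−a) + a(1−λ²)]`
by `a ≤ c` and `1−λ ≤ 1−a`.
[cite: KozmaNitzan2024, Question 8 (§5.5 p. 36)] -/
theorem kG0_F1 (lam a c : ℝ) (hl0 : 0 ≤ lam) (hl1 : lam ≤ 1) (ha0 : 0 ≤ a) (hac : a ≤ c) (hc : c * (1 + lam) ≤ lam) :
    (lam - c * (1 + lam)) * (c - a) * (lam * (1 - a) + a * (1 - lam ^ 2)) ≤ c * lam ^ 2 * (1 - a) ^ 2 := by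
  have hc0 : 0 ≤ c := le_trans ha0 hac
  have hlp : 0 ≤ lam - c * (1 + lam) := by linarith
  have h1a : 0 ≤ 1 - a := by nlinarith
  have s1 : c - a ≤ c * (1 - a) := by nlinarith
  have hB : 0 ≤ lam * (1 - a) + a * (1 - lam ^ 2) := by
    have : 0 ≤ 1 - lam ^ 2 := by nlinarith
    positivity
  have s2 : (lam - c * (1 + lam)) * (c - a) * (lam * (1 - a) + a * (1 - lam ^ 2))
      ≤ (lam - c * (1 + lam)) * (c * (1 - a)) * (lam * (1 - a) + a * (1 - lam ^ 2)) := by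
    have := mul_le_mul_of_nonneg_left s1 hlp
    exact mul_le_mul_of_nonneg_right this hB
  have s3 : (lam - c * (1 + lam)) * (lam * (1 - a) + a * (1 - lam ^ 2)) ≤ lam ^ 2 * (1 - a) := by
    have t1 : lam * a * (1 - lam ^ 2) ≤ a * (1 + lam) * (lam * (1 - a)) := by
      nlinarith [mul_nonneg ha0 (by nlinarith : (0:ℝ) ≤ (1 + lam) * (lam * (1 - a)) - (1 + lam) * (lam * (1 - lam)))]
    have t2 : a * (1 + lam) * (lam * (1 - a)) ≤ c * (1 + lam) * (lam * (1 - a) + a * (1 - lam ^ 2)) := by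
      have u1 : a * (1 + lam) * (lam * (1 - a)) ≤ c * (1 + lam) * (lam * (1 - a)) := by
        have : 0 ≤ (1 + lam) * (lam * (1 - a)) := by positivity
        nlinarith
      have u2 : 0 ≤ c * (1 + lam) * (a * (1 - lam ^ 2)) := by
        have : 0 ≤ 1 - lam ^ 2 := by nlinarith
        positivity
      nlinarith
    nlinarith
  have s4 := mul_le_mul_of_nonneg_left s3 (mul_nonneg hc0 h1a)
  have e1 : (lam - c * (1 + lam)) * (c * (1 - a)) * (lam * (1 - a) + a * (1 - lam ^ 2))
      = c * (1 - a) * ((lam - c * (1 + lam)) * (lam * (1 - a) + a * (1 - lam ^ 2))) := by ring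
  have e2 : c * (1 - a) * (lam ^ 2 * (1 - a)) = c * lam ^ 2 * (1 - a) ^ 2 := by ring
  linarith [s2, s4, e1, e2]

set_option maxHeartbeats 400000 in
/-- Auxiliary polynomial fact for **G2**: `(λ − a(1+λ))(2 − a − λ)² ≤ (1+λ)(1−a)³` for `0 ≤ a(1+λ) ≤ λ ≤ 1` (minimum `¼` of the
difference at `λ = 1, a = ½`).
[cite: KozmaNitzan2024, Question 8 (§5.5 p. 36)] -/
theorem kG0_G2aux (lam a : ℝ) (hl0 : 0 ≤ lam) (hl1 : lam ≤ 1) (ha0 : 0 ≤ a) (ha : a * (1 + lam) ≤ lam) :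
    (lam - a * (1 + lam)) * (2 - a - lam) ^ 2 ≤ (1 + lam) * (1 - a) ^ 3 := by
  have h1 : 0 ≤ lam - a * (1 + lam) := by linarith
  have h2 : a ≤ 1 / 2 := by nlinarith
  have h3 : 0 ≤ 1 - a := by linarith
  nlinarith [mul_nonneg h1 h3, mul_nonneg (mul_nonneg h1 h3) h3, mul_nonneg h1 (sq_nonneg (1 - a - lam)),
    mul_nonneg ha0 h3, mul_nonneg (mul_nonneg ha0 h3) h3, mul_nonneg hl0 h3, sq_nonneg (a - lam / 2),
    mul_nonneg (mul_nonneg hl0 (by linarith : (0:ℝ) ≤ 1 - lam)) h3, mul_nonneg h1 (mul_nonneg hl0 h3)]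

/-- **G2** (the vertex case of the scalar lemma): for `a, d ≥ 0` with `(a+d)(1+λ) ≤ λ ≤ 1`:
`d·(λ(1−a) + a(1−λ²))² ≤ λ²(1−a)³` (max ratio `½`).  Proof: `a(1−λ²) ≤ λ(1−λ)`, so the bracket is `≤ λ(2−a−λ)`,
`d(1+λ) ≤ λ − a(1+λ)`, and `kG0_G2aux`.
[cite: KozmaNitzan2024, Question 8 (§5.5 p. 36)] -/
theorem kG0_G2 (lam a d : ℝ) (hl0 : 0 ≤ lam) (hl1 : lam ≤ 1) (ha0 : 0 ≤ a) (hd0 : 0 ≤ d) (had : (a + d) * (1 + lam) ≤ lam) :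
    d * (lam * (1 - a) + a * (1 - lam ^ 2)) ^ 2 ≤ lam ^ 2 * (1 - a) ^ 3 := by
  have ha : a * (1 + lam) ≤ lam := by nlinarith
  have hS0 : 0 ≤ lam * (1 - a) + a * (1 - lam ^ 2) := by
    have : 0 ≤ 1 - lam ^ 2 := by nlinarith
    have : 0 ≤ 1 - a := by nlinarith
    positivity
  have hS : lam * (1 - a) + a * (1 - lam ^ 2) ≤ lam * (2 - a - lam) := by
    have : a * (1 - lam ^ 2) ≤ lam * (1 - lam) := by
      have e : a * (1 - lam ^ 2) = (a * (1 + lam)) * (1 - lam) := by ring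
      rw [e]; exact mul_le_mul_of_nonneg_right ha (by linarith)
    nlinarith
  have hS2 : (lam * (1 - a) + a * (1 - lam ^ 2)) ^ 2 ≤ (lam * (2 - a - lam)) ^ 2 := by
    have := mul_le_mul hS hS hS0 (by linarith); nlinarith [this]
  have hpos : 0 < 1 + lam := by linarith
  have hd : d * (1 + lam) ≤ lam - a * (1 + lam) := by nlinarith
  have step1 : d * (lam * (1 - a) + a * (1 - lam ^ 2)) ^ 2 ≤ d * (lam * (2 - a - lam)) ^ 2 :=
    mul_le_mul_of_nonneg_left hS2 hd0
  have aux := kG0_G2aux lam a hl0 hl1 ha0 ha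
  have hsq : 0 ≤ lam ^ 2 * (2 - a - lam) ^ 2 := by positivity
  have step2 : (1 + lam) * (d * (lam * (2 - a - lam)) ^ 2) ≤ (lam - a * (1 + lam)) * (lam ^ 2 * (2 - a - lam) ^ 2) := by
    have e : (1 + lam) * (d * (lam * (2 - a - lam)) ^ 2) = (d * (1 + lam)) * (lam ^ 2 * (2 - a - lam) ^ 2) := by ring
    rw [e]; exact mul_le_mul_of_nonneg_right hd hsq
  have step3 : (lam - a * (1 + lam)) * (lam ^ 2 * (2 - a - lam) ^ 2) ≤ (1 + lam) * (lam ^ 2 * (1 - a) ^ 3) := by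
    have := mul_le_mul_of_nonneg_left aux (sq_nonneg lam)
    nlinarith [this]
  have : (1 + lam) * (d * (lam * (1 - a) + a * (1 - lam ^ 2)) ^ 2) ≤ (1 + lam) * (lam ^ 2 * (1 - a) ^ 3) := by
    calc (1 + lam) * (d * (lam * (1 - a) + a * (1 - lam ^ 2)) ^ 2) ≤ (1 + lam) * (d * (lam * (2 - a - lam)) ^ 2) :=
          mul_le_mul_of_nonneg_left step1 hpos.le
      _ ≤ (lam - a * (1 + lam)) * (lam ^ 2 * (2 - a - lam) ^ 2) := step2
      _ ≤ (1 + lam) * (lam ^ 2 * (1 - a) ^ 3) := step3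
  exact le_of_mul_le_mul_left this hpos

/-- **The scalar lemma of (RC-G⁰).**  With `λ′ = λ − c(1+λ) ≥ 0`, `d = c − a ≥ 0`, `A = 1−a`, `0 ≤ a ≤ c`, `λ ≤ 1`, and
`Q(x) = x² − (λ′ + λd)x + cλ²A` (LEMMA Q's quadratic, `x = v/m`): for every `x ≥ λ′`,  `a(1−λ²)d·x ≤ A·Q(x)`,
i.e. `φ(x) = Q(x)/x ≥ (a/A)(1−λ²)d`.  Proof: in `t = x − λ′` the difference is `At² + (Aλ′ − M)t + F` with
`M = d(λA + a(1−λ²))`, `F = cλ²A² − λ′M ≥ 0` (`kG0_F1`); if `Aλ′ < M` then `(Aλ′+M)² ≤ 4M² ≤ 4cλ²A³` (`kG0_G2`, `d ≤ c`),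
which is `4AF ≥ (Aλ′−M)²`.
[cite: KozmaNitzan2024, Question 8 (§5.5 p. 36)] -/
theorem kG0_scalar (lam a c x : ℝ) (hl0 : 0 ≤ lam) (hl1 : lam ≤ 1) (ha0 : 0 ≤ a) (hac : a ≤ c) (hc : c * (1 + lam) ≤ lam)
    (hx : lam - c * (1 + lam) ≤ x) :
    a * (1 - lam ^ 2) * (c - a) * x
      ≤ (1 - a) * (x ^ 2 - ((lam - c * (1 + lam)) + lam * (c - a)) * x + c * lam ^ 2 * (1 - a)) := by
  set lp := lam - c * (1 + lam) with hlp
  set d := c - a with hd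
  set A := 1 - a with hA
  set M := lam * d * A + a * (1 - lam ^ 2) * d with hM
  set t := x - lp with ht
  have ht0 : 0 ≤ t := by rw [ht]; linarith
  have hA0 : 0 < A := by
    have : c ≤ 1 / 2 := by nlinarith
    rw [hA]; linarith
  have hd0 : 0 ≤ d := by rw [hd]; linarith
  have hF : 0 ≤ c * lam ^ 2 * A ^ 2 - lp * M := by
    have h := kG0_F1 lam a c hl0 hl1 ha0 hac hc
    have e : (lam - c * (1 + lam)) * (c - a) * (lam * (1 - a) + a * (1 - lam ^ 2)) = lp * M := by
      rw [hlp, hM, hd, hA]; ring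
    rw [hA]; nlinarith [h, e]
  have hM2 : M ^ 2 ≤ c * lam ^ 2 * A ^ 3 := by
    have hg := kG0_G2 lam a d hl0 hl1 ha0 hd0 (by rw [hd]; nlinarith)
    have e : M = d * (lam * (1 - a) + a * (1 - lam ^ 2)) := by rw [hM, hA]; ring
    have hdc : d ≤ c := by rw [hd]; linarith
    calc M ^ 2 = d * (d * (lam * (1 - a) + a * (1 - lam ^ 2)) ^ 2) := by rw [e]; ring
      _ ≤ c * (d * (lam * (1 - a) + a * (1 - lam ^ 2)) ^ 2) := by
          apply mul_le_mul_of_nonneg_right hdc; positivity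
      _ ≤ c * (lam ^ 2 * (1 - a) ^ 3) := by
          apply mul_le_mul_of_nonneg_left hg; linarith
      _ = c * lam ^ 2 * A ^ 3 := by rw [hA]; ring
  have key : (1 - a) * (x ^ 2 - ((lam - c * (1 + lam)) + lam * (c - a)) * x + c * lam ^ 2 * (1 - a))
      - a * (1 - lam ^ 2) * (c - a) * x
      = A * t ^ 2 + (A * lp - M) * t + (c * lam ^ 2 * A ^ 2 - lp * M) := by
    rw [hA, ht, hM, hlp, hd]; ring
  rcases le_or_gt 0 (A * lp - M) with hB | hB
  · have h3 : 0 ≤ A * t ^ 2 + (A * lp - M) * t + (c * lam ^ 2 * A ^ 2 - lp * M) := by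
      linarith only [mul_nonneg hB ht0, mul_nonneg hA0.le (sq_nonneg t), hF]
    linarith only [key, h3]
  · have hlp0 : 0 ≤ lp := by rw [hlp]; linarith
    have h1 : (A * lp + M) ^ 2 ≤ 4 * M ^ 2 := by
      have hAlp : 0 ≤ A * lp := mul_nonneg hA0.le hlp0
      have hle : A * lp + M ≤ 2 * M := by linarith
      have h0 : 0 ≤ A * lp + M := by linarith
      have := mul_le_mul hle hle h0 (by linarith)
      have e2 : (2 * M) * (2 * M) = 4 * M ^ 2 := by ring
      have e3 : (A * lp + M) * (A * lp + M) = (A * lp + M) ^ 2 := by ring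
      linarith [this, e2, e3]
    have h4AF : (A * lp - M) ^ 2 ≤ 4 * A * (c * lam ^ 2 * A ^ 2 - lp * M) := by
      have e : 4 * A * (c * lam ^ 2 * A ^ 2 - lp * M) - (A * lp - M) ^ 2 = 4 * (c * lam ^ 2 * A ^ 3) - (A * lp + M) ^ 2 := by ring
      linarith [e, h1, hM2]
    have hq : 0 ≤ 4 * A * (A * t ^ 2 + (A * lp - M) * t + (c * lam ^ 2 * A ^ 2 - lp * M)) := by
      have e : 4 * A * (A * t ^ 2 + (A * lp - M) * t + (c * lam ^ 2 * A ^ 2 - lp * M))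
          = (2 * A * t + (A * lp - M)) ^ 2 + (4 * A * (c * lam ^ 2 * A ^ 2 - lp * M) - (A * lp - M) ^ 2) := by ring
      rw [e]; have hsq := sq_nonneg (2 * A * t + (A * lp - M)); linarith only [hsq, h4AF]
    have h4A : 0 < 4 * A := by linarith only [hA0]
    have h2 : 0 ≤ A * t ^ 2 + (A * lp - M) * t + (c * lam ^ 2 * A ^ 2 - lp * M) :=
      le_of_mul_le_mul_left (by linarith only [hq]) h4A
    linarith only [key, h2]

/-- **Far-factor identity.**  With `q = (1−s)p + sm`, `p = u+v+m`, `M₁ = A + C − AC`, `p₀ = M₁q + sCu + sAv`,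
`a = 1−A`, `d = A − C`:  `A·p = p₀ + s·d·u − C·a·q` (CLAIM Z's first step, with the remainder kept exactly).
[cite: KozmaNitzan2024, Question 8 (§5.5 p. 36)] -/
theorem kG0_Ap (A C s u v m p q M₁ p₀ a d : ℝ) (hp : p = u + v + m) (hq : q = (1 - s) * p + s * m)
    (hM : M₁ = A + C - A * C) (hp0 : p₀ = M₁ * q + s * C * u + s * A * v) (ha : a = 1 - A) (hd : d = A - C) :
    A * p = p₀ + s * d * u - C * a * q := by
  rw [hp0, hq, hM, hp, ha, hd]; ring

/-- **The depth-0 excess without R** (multiplied by `A·p₀ > 0`).  With `B_p ≥ 0`, `B_q ≥ B_p`, `A·B_p ≤ p₀`, `0 ≤ λ ≤ 1`,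
`a ≥ 0`, `A ≥ 0` and `A·p = p₀ + ρ` (`ρ = s·d·u − C·a·q`, `kG0_Ap`):
`A·a·[(1−λ²)·A·p·B_p − B_q·p₀] ≤ a·(1−λ²)·max(ρ,0)·p₀`, i.e. `a[(1−λ²)ApB_p/p₀ − B_q] ≤ (a/A)(1−λ²)ρ⁺` — the term CLAIM Z
bounds by `¾p₀` (the R-kill) is kept as `(a/A)(1−λ²)ρ⁺`, and the `−aλ²B_p − a(B_q − B_p)` part is dropped.
[cite: KozmaNitzan2024, Question 8 (§5.5 p. 36)] -/
theorem kG0_xz_bound (a A lam p p₀ Bp Bq ρ : ℝ) (ha : 0 ≤ a) (hA : 0 ≤ A) (hl0 : 0 ≤ lam) (hl1 : lam ≤ 1)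
    (hBp : 0 ≤ Bp) (hBq : Bp ≤ Bq) (hAB : A * Bp ≤ p₀) (hAp : A * p = p₀ + ρ) :
    A * (a * ((1 - lam ^ 2) * A * p * Bp - Bq * p₀)) ≤ a * (1 - lam ^ 2) * max ρ 0 * p₀ := by
  have hl2 : 0 ≤ 1 - lam ^ 2 := by nlinarith
  have hl3 : 1 - lam ^ 2 ≤ 1 := by nlinarith
  have hp0 : 0 ≤ p₀ := le_trans (mul_nonneg hA hBp) hAB
  have hρ : ρ ≤ max ρ 0 := le_max_left _ _
  have hm0 : 0 ≤ max ρ 0 := le_max_right _ _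
  -- (1−λ²)A p Bp = (1−λ²)Bp p₀ + (1−λ²)Bp ρ
  have e1 : (1 - lam ^ 2) * A * p * Bp = (1 - lam ^ 2) * Bp * p₀ + (1 - lam ^ 2) * Bp * ρ := by
    rw [show (1 - lam ^ 2) * A * p * Bp = (1 - lam ^ 2) * Bp * (A * p) by ring, hAp]; ring
  -- (1−λ²)Bp p₀ ≤ Bq p₀ ;  A (1−λ²) Bp ρ ≤ A(1−λ²)Bp max(ρ,0) ≤ (1−λ²) p₀ max(ρ,0)
  have t1 : (1 - lam ^ 2) * Bp * p₀ ≤ Bq * p₀ := by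
    have : (1 - lam ^ 2) * Bp ≤ Bq := by nlinarith
    exact mul_le_mul_of_nonneg_right this hp0
  have t2 : A * ((1 - lam ^ 2) * Bp * ρ) ≤ (1 - lam ^ 2) * max ρ 0 * p₀ := by
    have u1 : (1 - lam ^ 2) * Bp * ρ ≤ (1 - lam ^ 2) * Bp * max ρ 0 := mul_le_mul_of_nonneg_left hρ (mul_nonneg hl2 hBp)
    have u2 : A * ((1 - lam ^ 2) * Bp * max ρ 0) = (1 - lam ^ 2) * max ρ 0 * (A * Bp) := by ring
    have u3 : (1 - lam ^ 2) * max ρ 0 * (A * Bp) ≤ (1 - lam ^ 2) * max ρ 0 * p₀ :=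
      mul_le_mul_of_nonneg_left hAB (mul_nonneg hl2 hm0)
    nlinarith [mul_le_mul_of_nonneg_left u1 hA, u2, u3]
  have t3 : A * (a * ((1 - lam ^ 2) * A * p * Bp - Bq * p₀)) = a * (A * ((1 - lam ^ 2) * Bp * p₀ - Bq * p₀) + A * ((1 - lam ^ 2) * Bp * ρ)) := by
    rw [e1]; ring
  rw [t3]
  have t4 : A * ((1 - lam ^ 2) * Bp * p₀ - Bq * p₀) ≤ 0 := by
    have : (1 - lam ^ 2) * Bp * p₀ - Bq * p₀ ≤ 0 := by linarith
    exact mul_nonpos_of_nonneg_of_nonpos hA this |> fun h => h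
  nlinarith [mul_le_mul_of_nonneg_left (show A * ((1 - lam ^ 2) * Bp * p₀ - Bq * p₀) + A * ((1 - lam ^ 2) * Bp * ρ)
      ≤ (1 - lam ^ 2) * max ρ 0 * p₀ by linarith) ha]

/-- **The slack of the w = 0 chain.**  With `x = v/m` (`m, v > 0`), Chebyshev `uv ≤ T′m` (so `ux ≤ T′`), `q ≥ sm`, `λ′ ≥ 0`,
`M₁ ≥ 0`, `T′ ≥ 0`, `0 ≤ s ≤ 1`:  `kb2 + ll − n3 ≥ s·u·φ(x) + (1−s)M₁T′` where `kb2 = ((1−s)M₁ + s)T′ − sλ′u`,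
`ll = cλ²Aqu/v`, `n3 = sλdu`, `φ(x) = x − λ′ − λd + cλ²A/x`.
[cite: KozmaNitzan2024, Question 8 (§5.5 p. 36)] -/
theorem kG0_spare (s u v m T' q lamp lam d c A M₁ : ℝ) (hs0 : 0 ≤ s) (hu : 0 ≤ u) (hv : 0 < v) (hm : 0 < m)
    (hcheb : u * v ≤ T' * m) (hq : s * m ≤ q) (hc : 0 ≤ c) (hA : 0 ≤ A) :
    s * u * (v / m - lamp - lam * d + c * lam ^ 2 * A / (v / m)) + (1 - s) * M₁ * T'
      ≤ ((1 - s) * M₁ + s) * T' - s * lamp * u + c * lam ^ 2 * A * q * u / v - s * lam * d * u := by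
  -- u·(v/m) ≤ T′ and cλ²A·s·u/(v/m) = cλ²A·s·m·u/v ≤ cλ²A·q·u/v
  have h1 : u * (v / m) ≤ T' := by
    rw [mul_div_assoc', div_le_iff₀ hm]
    linarith
  have h2 : s * u * (c * lam ^ 2 * A / (v / m)) = c * lam ^ 2 * A * (s * m) * u / v := by
    field_simp
  have h3 : c * lam ^ 2 * A * (s * m) * u / v ≤ c * lam ^ 2 * A * q * u / v := by
    apply div_le_div_of_nonneg_right _ hv.le
    have : 0 ≤ c * lam ^ 2 * A := by positivity
    have := mul_le_mul_of_nonneg_left hq this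
    exact mul_le_mul_of_nonneg_right this hu
  have h4 : s * u * (v / m) ≤ s * T' := by
    have := mul_le_mul_of_nonneg_left h1 hs0
    linarith [this]
  have e : s * u * (v / m - lamp - lam * d + c * lam ^ 2 * A / (v / m))
      = s * u * (v / m) - s * lamp * u - s * lam * d * u + s * u * (c * lam ^ 2 * A / (v / m)) := by ring
  rw [e, h2]
  nlinarith [h3, h4]

end PocketCert

end Summit.CriticalPhenomena.PercolationContinuityZ3.Theorems
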